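import Mathlib.Combinatorics.SetFamily.FourFunctions
import Literature.Probability.Percolation.PercolationProofs
import Literature.Probability.LatticeModels.ProdBernoulliClusterLocality
import Literature.Probability.Percolation.ConditionalPositiveAssociationProofs
import HarnessLib

/-!
# Crux `PercNearOneGluing.AdditiveGluing` (stmt-CriticalPhenomena-4576), line `subuniform-dead-pocket-maximum`
# — a DECORATED van den Berg–Häggström–Kahn inequality, I: pocket locality and the base case

Helper file for the crux (siege seat k17 on the stub `stub_goodStep` of the skeleton
`Cruxes/AdditiveGluing/Lines/subuniform-dead-pocket-maximum.lean`, variation "C1 kernel first");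
lands with `--supports stmt-CriticalPhenomena-4576`.  No new definitions: everything is phrased in
the finite-sum framework of the tree's proof of BHK 2006 Thm 1.1
(`Literature.Probability.Percolation.BHK2006`: `weight`, `ind`, `edgesIn`, `meeting`, `rC`, `rD`,
`rS`, percolation restricted to a vertex set `U`).

## The inequality (GNEG) and why

Two sources: `g` (owner of an increasing cluster function `F ≥ 0`, BHK's `s`) and `o` (owner of the
"pocket" `K = C(o)`, here `openCluster (ω ∩ edgesIn U) o`).  A DECORATION is a function
`q : Set V → Set V → ℝ`, `q X K ∈ [0, 1]`, with `q X K = 1` when `K` meets `X`, `q X K = q ∅ K`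
when `K` misses `X`, and `q ∅ K = 0` when `g ∈ K` (think `q X K = 1{K ∩ X ≠ ∅ ∨ K ∈ 𝓡}` for a family
`𝓡` of vertex sets avoiding `g`).  GNEG (file II, `gneg_core`): for all `X, Y ⊆ U`,

  `E[F(C_g) q_X(K) 1{g ↮ X}] · P(g ↮ Y) ≤ E[F(C_g) 1{g ↮ X ∩ Y}] · E[q_{X∪Y}(K) 1{g ↮ X ∪ Y}]`.

For `q ≡ 1` this is BHK Thm 1.1 with `B ≡ 1`; for `X = Y = {s}` it says that, GIVEN `g ↮ s`, the
function `F(C_g)` is NEGATIVELY correlated with every event `Q` of the cluster of `o` such that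
`{s ∈ C(o)} ⊆ Q ⊆ {g ∉ C(o)}` — BHK Thm 1.5 is `Q = {o ↔ s}`, and the freedom in `Q` ("adversarial
dead-pocket selection") is exactly what the `|A ∖ b| = 2` kernel (lead c1's conjecture C1) of the
good-quadruple inequality needs (file IV).  The proof is BHK's induction on `U`; this file supplies
the two new ingredients: (a) the pocket event `{K = W}` is a block event for the edges meeting `W`,
on which `g`'s cluster and avoidance events (`g ∉ W`) are those of `U ∖ W` (`gneg_blockFactor`), and
(b) the BASE CASE `X ∩ Y = ∅` (`gneg_base`): decompose over the value `W` of `K` and chain Harris in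
`U ∖ W` with the monotonicity of `rC`, `rD` in `U`.
-/

namespace Summit.CriticalPhenomena.PercolationContinuityZ3.Theorems

open Literature.Probability.Percolation Literature.Probability.Percolation.BHK2006 DecisionTree
open Literature.Probability.LatticeModels (reachable_fromEdgeSet_inter_of_walk)
open scoped Classical

variable {V : Type*}

/-! ### Pointwise facts about the restricted cluster `K = openCluster (ω ∩ edgesIn U) o` -/

/-- The restricted cluster of `o` is monotone in the vertex set `U`. [folklore] -/
theorem gneg_openCluster_mono_U {U U' : Finset V} (h : U' ⊆ U) (ω : Set (Sym2 V)) (o : V) :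
    openCluster (ω ∩ edgesIn U') o ⊆ openCluster (ω ∩ edgesIn U) o := fun _ hv =>
  SimpleGraph.Reachable.mono (openGraph_le (Set.inter_subset_inter_right _ (edgesIn_mono h))) hv

/-- The restricted cluster of `o` is monotone in the configuration. [folklore] -/
theorem gneg_openCluster_mono {U : Finset V} {ω ω' : Set (Sym2 V)} (h : ω ⊆ ω') (o : V) :
    openCluster (ω ∩ edgesIn U) o ⊆ openCluster (ω' ∩ edgesIn U) o := fun _ hv =>
  SimpleGraph.Reachable.mono (openGraph_le (Set.inter_subset_inter_left _ h)) hv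

/-- A vertex of the restricted cluster other than `o` lies in `U`. [folklore] -/
theorem gneg_mem_U_of_mem_openCluster {U : Finset V} {ω : Set (Sym2 V)} {o v : V}
    (hv : v ∈ openCluster (ω ∩ edgesIn U) o) (hvo : v ≠ o) : v ∈ U := by
  have hr : (openGraph (ω ∩ edgesIn U)).Reachable o v := hv
  rw [SimpleGraph.reachable_iff_reflTransGen] at hr
  induction hr with
  | refl => exact absurd rfl hvo
  | tail _ hbc _ => exact (adj_iff.1 hbc).2.1.2

/-- No open `U`-edge leaves the restricted cluster. [folklore] -/
theorem gneg_boundary_closed {U : Finset V} {ω : Set (Sym2 V)} {o u v : V}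
    (hu : u ∈ openCluster (ω ∩ edgesIn U) o) (hv : v ∉ openCluster (ω ∩ edgesIn U) o) :
    s(u, v) ∉ ω ∩ edgesIn U := fun he =>
  hv ((show (openGraph (ω ∩ edgesIn U)).Reachable o u from hu).trans
    (SimpleGraph.Adj.reachable ((openGraph_adj _ u v).2 ⟨he, fun h => hv (h ▸ hu)⟩)))

/-- **Pocket locality.** The event `{K = W}` depends only on the edges meeting `W`:
`K(ω) = W ↔ K(ω ∩ meeting W) = W`. [folklore] -/
theorem gneg_openCluster_eq_iff_inter_meeting (U W : Finset V) (ω : Set (Sym2 V)) (o : V) :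
    openCluster (ω ∩ edgesIn U) o = ↑W ↔ openCluster ((ω ∩ meeting W) ∩ edgesIn U) o = ↑W := by
  constructor
  · intro hK
    refine Set.Subset.antisymm ((gneg_openCluster_mono Set.inter_subset_left o).trans hK.subset) ?_
    intro v hv
    rw [← hK] at hv
    obtain ⟨p⟩ := (show (openGraph (ω ∩ edgesIn U)).Reachable o v from hv)
    have hN : ∀ u ∈ openCluster (ω ∩ edgesIn U) o, ∀ v ∉ openCluster (ω ∩ edgesIn U) o,
        s(u, v) ∉ ω ∩ edgesIn U := fun u hu v hv => gneg_boundary_closed hu hv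
    have hr := reachable_fromEdgeSet_inter_of_walk hN p (SimpleGraph.Reachable.refl o)
    refine hr.mono (openGraph_le ?_)
    rintro e ⟨⟨heω, heU⟩, heK⟩
    refine ⟨⟨heω, ?_⟩, heU⟩
    induction e using Sym2.ind with
    | h a b =>
      have ha : a ∈ (W : Set V) := hK ▸ heK a (Sym2.mem_mk_left a b)
      exact ⟨a, ha, Sym2.mem_mk_left a b⟩
  · intro hK
    refine Set.Subset.antisymm ?_ (hK.symm.subset.trans (gneg_openCluster_mono Set.inter_subset_left o))
    intro v hv
    have hr : (openGraph (ω ∩ edgesIn U)).Reachable o v := hv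
    rw [SimpleGraph.reachable_iff_reflTransGen] at hr
    rw [← hK]
    show (openGraph ((ω ∩ meeting W) ∩ edgesIn U)).Reachable o v
    clear hv
    induction hr with
    | refl => exact SimpleGraph.Reachable.refl o
    | @tail b c _ hbc ih =>
      obtain ⟨hω, hbcU, hne⟩ := adj_iff.1 hbc
      have hbW : b ∈ (W : Set V) := hK ▸ (show b ∈ openCluster ((ω ∩ meeting W) ∩ edgesIn U) o from ih)
      exact ih.trans (SimpleGraph.Adj.reachable
        (adj_iff.2 ⟨⟨hω, b, hbW, Sym2.mem_mk_left b c⟩, hbcU, hne⟩))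

/-- On the pocket event `{K = W}` no vertex outside `W` has an open edge to `W`: BHK's layer `S`
of `Z := W` is empty (for `o ∈ U`). [folklore] -/
theorem gneg_rS_eq_empty {U W : Finset V} {ω : Set (Sym2 V)} {o : V} (ho : o ∈ U)
    (hK : openCluster (ω ∩ edgesIn U) o = ↑W) : rS U W ω = ∅ := by
  refine Set.eq_empty_of_forall_notMem fun n hn => ?_
  obtain ⟨hnUW, z, hzW, hnz⟩ := hn
  obtain ⟨hnU, hnW⟩ := Finset.mem_sdiff.1 hnUW
  have hzK : z ∈ openCluster (ω ∩ edgesIn U) o := by rw [hK]; exact hzW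
  have hzU : z ∈ U := by
    by_cases hzo : z = o
    · rw [hzo]; exact ho
    · exact gneg_mem_U_of_mem_openCluster hzK hzo
  have hnK : n ∉ openCluster (ω ∩ edgesIn U) o := by rw [hK]; exact fun h => hnW h
  refine gneg_boundary_closed hzK hnK ⟨?_, mem_edgesIn_mk.2 ⟨hzU, hnU⟩⟩
  rw [Sym2.eq_swap]; exact hnz

/-- On `{K = W}` with `g ∉ W`, the cluster of `g` in `G[U]` is its cluster in `G[U ∖ W]`.
[folklore] -/
theorem gneg_rC_pocket {U W : Finset V} {ω : Set (Sym2 V)} {o g : V} (ho : o ∈ U)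
    (hK : openCluster (ω ∩ edgesIn U) o = ↑W) (hg : g ∉ W) : rC U g ω = rC (U \ W) g ω :=
  rC_restrict hg fun n hn => by rw [gneg_rS_eq_empty ho hK] at hn; exact absurd hn (Set.notMem_empty n)

/-- On `{K = W}` with `g ∉ W`, the avoidance events of `g` in `G[U]` are those of `G[U ∖ W]`.
[folklore] -/
theorem gneg_rD_pocket {U W : Finset V} {ω : Set (Sym2 V)} {o g : V} (ho : o ∈ U)
    (hK : openCluster (ω ∩ edgesIn U) o = ↑W) (hg : g ∉ W) (S : Set V) :
    ω ∈ rD U g S ↔ ω ∈ rD (U \ W) g S := by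
  constructor
  · exact fun h x hx hr => h x hx (hr.mono (openGraph_le
      (Set.inter_subset_inter_right _ (edgesIn_mono Finset.sdiff_subset))))
  · intro h x hx hr
    have hS : ∀ n ∈ rS U W ω, ¬ (openGraph (ω ∩ edgesIn (U \ W))).Reachable g n := fun n hn => by
      rw [gneg_rS_eq_empty ho hK] at hn; exact absurd hn (Set.notMem_empty n)
    exact h x hx (reach_restrict hg hS hr).2


/-! ### Block factorization over a pocket and the fiber decomposition -/

section Sums

variable [Fintype V]

/-- Indicators of events that agree on two configurations agree. [folklore] -/
theorem gneg_ind_congr {α : Type*} {D D' : Set α} {a b : α} (h : a ∈ D ↔ b ∈ D') :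
    ind D a = ind D' b := by
  by_cases ha : a ∈ D
  · rw [ind_of_mem ha, ind_of_mem (h.1 ha)]
  · rw [ind_of_not_mem ha, ind_of_not_mem fun hb => ha (h.2 hb)]

/-- **Block factorization over a pocket.** For `g ∉ W` and `o ∈ U`:
`E[1{K = W} · H(C_g^U) 1{g ↮ S in U}] = P(K = W) · E[H(C_g^{U∖W}) 1{g ↮ S in U ∖ W}]` — the pocket
event is a block event for the edges meeting `W`, on which `g`'s cluster lives in `U ∖ W`
(spatial Markov property of a pocket, finite-sum form). [folklore] -/
theorem gneg_blockFactor (w : Sym2 V → ℝ) (hm : ∑ ω, weight w ω = 1) {U W : Finset V} {o g : V}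
    (ho : o ∈ U) (hg : g ∉ W) (H : Set (Sym2 V) → ℝ) (S : Set V) :
    ∑ ω, weight w ω * (ind {ω | openCluster (ω ∩ edgesIn U) o = ↑W} ω *
        (H (rC U g ω) * ind (rD U g S) ω)) =
      (∑ ω, weight w ω * ind {ω | openCluster (ω ∩ edgesIn U) o = ↑W} ω) *
        ∑ ω, weight w ω * (H (rC (U \ W) g ω) * ind (rD (U \ W) g S) ω) := by
  set A := meeting W with hA
  set P : Set (Set (Sym2 V)) := {ω | openCluster (ω ∩ edgesIn U) o = ↑W} with hP
  set Ψ : Set (Sym2 V) → ℝ := fun η => H (rC (U \ W) g η) * ind (rD (U \ W) g S) η with hΨ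
  set Φ : Set (Sym2 V) → Set (Sym2 V) → ℝ := fun ζ η => ind P ζ * Ψ η with hΦ
  have hPA : ∀ ω, ω ∩ A ∈ P ↔ ω ∈ P := fun ω =>
    (gneg_openCluster_eq_iff_inter_meeting U W ω o).symm
  have hΨA : ∀ ω, Ψ (ω \ A) = Ψ ω := fun ω => by
    simp only [hΨ, hA, rC_diff_meeting]
    rw [gneg_ind_congr (mem_rD_diff_meeting U W g S ω)]
  have h1 : ∀ ω, ind P ω * (H (rC U g ω) * ind (rD U g S) ω) = Φ (ω ∩ A) (ω \ A) := by
    intro ω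
    simp only [hΦ]
    rw [gneg_ind_congr (hPA ω), hΨA]
    by_cases hω : ω ∈ P
    · have hK : openCluster (ω ∩ edgesIn U) o = ↑W := hω
      simp only [hΨ]
      rw [gneg_rC_pocket ho hK hg, gneg_ind_congr (gneg_rD_pocket ho hK hg S)]
    · rw [ind_of_not_mem hω, zero_mul, zero_mul]
  have h2 : ∀ ω ω', Φ (ω ∩ A) (ω' \ A) = ind P ω * Ψ ω' := fun ω ω' => by
    simp only [hΦ]
    rw [gneg_ind_congr (hPA ω), hΨA]
  calc ∑ ω, weight w ω * (ind P ω * (H (rC U g ω) * ind (rD U g S) ω))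
      = (∑ ω, weight w ω) * ∑ ω, weight w ω * Φ (ω ∩ A) (ω \ A) := by
        rw [hm, one_mul]; simp_rw [h1]
    _ = ∑ ω, weight w ω * ∑ ω', weight w ω' * Φ (ω ∩ A) (ω' \ A) := blockFubini w A Φ
    _ = ∑ ω, weight w ω * ind P ω * ∑ ω', weight w ω' * Ψ ω' := by
        refine Finset.sum_congr rfl fun ω _ => ?_
        simp_rw [h2]
        rw [Finset.mul_sum, Finset.mul_sum]
        refine Finset.sum_congr rfl fun ω' _ => ?_
        ring
    _ = (∑ ω, weight w ω * ind P ω) * ∑ ω, weight w ω * Ψ ω := by rw [Finset.sum_mul]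

/-- **Fiber decomposition over the value of the pocket.** [folklore] -/
theorem gneg_fiber (w : Sym2 V → ℝ) (U : Finset V) (o : V) (c : Set V → ℝ)
    (φ : Set (Sym2 V) → ℝ) :
    ∑ ω, weight w ω * (c (openCluster (ω ∩ edgesIn U) o) * φ ω) =
      ∑ W : Finset V, c ↑W *
        ∑ ω, weight w ω * (ind {ω | openCluster (ω ∩ edgesIn U) o = ↑W} ω * φ ω) := by
  simp_rw [Finset.mul_sum]
  rw [Finset.sum_comm]
  refine Finset.sum_congr rfl fun ω _ => ?_
  set K₀ := openCluster (ω ∩ edgesIn U) o with hK₀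
  rw [Finset.sum_eq_single K₀.toFinset]
  · have hmem : ω ∈ {ω' : Set (Sym2 V) | openCluster (ω' ∩ edgesIn U) o = ↑K₀.toFinset} := by
      show openCluster (ω ∩ edgesIn U) o = ↑K₀.toFinset
      rw [Set.coe_toFinset]
    rw [ind_of_mem hmem, Set.coe_toFinset]
    ring
  · intro W _ hW
    have hnm : ω ∉ {ω' : Set (Sym2 V) | openCluster (ω' ∩ edgesIn U) o = ↑W} := fun h => hW (by
      apply Finset.coe_injective
      rw [Set.coe_toFinset]
      exact h.symm)
    rw [ind_of_not_mem hnm]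
    ring
  · exact fun h => absurd (Finset.mem_univ _) h

end Sums

/-! ### The base case `X ∩ Y = ∅` -/

section Base

variable [Fintype V]

omit [Fintype V] in
/-- On a pocket `K = W` containing `g` and meeting `X`, the vertex `g` reaches `X`: the
avoidance indicator vanishes. [folklore] -/
theorem gneg_ind_rD_eq_zero_of_mem {U W : Finset V} {ω : Set (Sym2 V)} {o g x : V} {X : Set V}
    (hK : openCluster (ω ∩ edgesIn U) o = ↑W) (hg : g ∈ W) (hxX : x ∈ X) (hxW : x ∈ W) :
    ind (rD U g X) ω = 0 := by
  refine ind_of_not_mem fun hω => hω x hxX ?_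
  have hgK : g ∈ openCluster (ω ∩ edgesIn U) o := by rw [hK]; exact hg
  have hxK : x ∈ openCluster (ω ∩ edgesIn U) o := by rw [hK]; exact hxW
  exact (show (openGraph (ω ∩ edgesIn U)).Reachable o g from hgK).symm.trans hxK

/-- **GNEG, base case `X ∩ Y = ∅`.**  For a decoration `q` (only `0 ≤ q_X ≤ q_{X∪Y}` and
"`g ∈ K`, `q_X(K) ≠ 0` ⟹ `K` meets `X`" are used) and `F ≥ 0` increasing:
`E[F(C_g) q_X(K) 1{g↮X}] · P(g↮Y) ≤ E[F(C_g)] · E[q_{X∪Y}(K) 1{g ↮ X∪Y}]`.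
Proof: decompose over the value `W` of the pocket `K`; for `g ∉ W` factor the pocket off
(`gneg_blockFactor`) and chain Harris in `U ∖ W` with the monotonicity of `rC`, `rD` in `U`.
[this project; the case `q ≡ 1` is BHK 2006 display (4)] -/
theorem gneg_base (w : Sym2 V → ℝ) (hw0 : ∀ e, 0 ≤ w e) (hw1 : ∀ e, w e ≤ 1)
    (hm : ∑ ω, weight w ω = 1) {U : Finset V} {o g : V} (ho : o ∈ U) {X Y : Set V}
    (F : Set (Sym2 V) → ℝ) (hF : Monotone F) (hF0 : ∀ a, 0 ≤ F a)
    (q : Set V → Set V → ℝ) (hq0 : ∀ K, 0 ≤ q X K) (hqm : ∀ K, q X K ≤ q (X ∪ Y) K)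
    (hqg : ∀ K, g ∈ K → q X K ≠ 0 → ∃ x ∈ X, x ∈ K) :
    (∑ ω, weight w ω * (F (rC U g ω) * q X (openCluster (ω ∩ edgesIn U) o) * ind (rD U g X) ω)) *
      (∑ ω, weight w ω * ind (rD U g Y) ω) ≤
    (∑ ω, weight w ω * F (rC U g ω)) *
      ∑ ω, weight w ω * (q (X ∪ Y) (openCluster (ω ∩ edgesIn U) o) * ind (rD U g (X ∪ Y)) ω) := by
  -- abbreviations
  set A₂ := ∑ ω, weight w ω * ind (rD U g Y) ω with hA₂
  set A₃ := ∑ ω, weight w ω * F (rC U g ω) with hA₃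
  set P : Finset V → ℝ := fun W =>
    ∑ ω, weight w ω * ind {ω | openCluster (ω ∩ edgesIn U) o = ↑W} ω with hP
  set I₁ : Finset V → ℝ := fun W => ∑ ω, weight w ω *
    (ind {ω | openCluster (ω ∩ edgesIn U) o = ↑W} ω * (F (rC U g ω) * ind (rD U g X) ω)) with hI₁
  set I₄ : Finset V → ℝ := fun W => ∑ ω, weight w ω *
    (ind {ω | openCluster (ω ∩ edgesIn U) o = ↑W} ω * ind (rD U g (X ∪ Y)) ω) with hI₄
  -- fiber decompositions of the two decorated sums
  have e1 : ∑ ω, weight w ω * (F (rC U g ω) * q X (openCluster (ω ∩ edgesIn U) o) *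
      ind (rD U g X) ω) = ∑ W : Finset V, q X ↑W * I₁ W := by
    rw [← gneg_fiber w U o (q X) fun ω => F (rC U g ω) * ind (rD U g X) ω]
    refine Finset.sum_congr rfl fun ω _ => ?_
    ring
  have e4 : ∑ ω, weight w ω * (q (X ∪ Y) (openCluster (ω ∩ edgesIn U) o) *
      ind (rD U g (X ∪ Y)) ω) = ∑ W : Finset V, q (X ∪ Y) ↑W * I₄ W := by
    rw [← gneg_fiber w U o (q (X ∪ Y))]
  rw [e1, e4, Finset.sum_mul, Finset.mul_sum]
  refine Finset.sum_le_sum fun W _ => ?_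
  -- nonnegativity
  have hA₂ : 0 ≤ A₂ :=
    Finset.sum_nonneg fun ω _ => mul_nonneg (weight_nonneg hw0 hw1 ω) (ind_nonneg _ _)
  have hA₃0 : 0 ≤ A₃ :=
    Finset.sum_nonneg fun ω _ => mul_nonneg (weight_nonneg hw0 hw1 ω) (hF0 _)
  have hPW : 0 ≤ P W :=
    Finset.sum_nonneg fun ω _ => mul_nonneg (weight_nonneg hw0 hw1 ω) (ind_nonneg _ _)
  have hI₄ : 0 ≤ I₄ W := Finset.sum_nonneg fun ω _ => mul_nonneg (weight_nonneg hw0 hw1 ω)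
    (mul_nonneg (ind_nonneg _ _) (ind_nonneg _ _))
  have hqXY : 0 ≤ q (X ∪ Y) ↑W := (hq0 _).trans (hqm _)
  have hR : 0 ≤ A₃ * (q (X ∪ Y) ↑W * I₄ W) := mul_nonneg hA₃0 (mul_nonneg hqXY hI₄)
  by_cases hgW : g ∈ W
  · -- a pocket containing `g`: the term vanishes
    suffices h0 : q X ↑W * I₁ W = 0 by rw [h0, zero_mul]; exact hR
    by_cases hq : q X ↑W = 0
    · rw [hq, zero_mul]
    obtain ⟨x, hxX, hxW⟩ := hqg (↑W) hgW hq
    have : I₁ W = 0 := Finset.sum_eq_zero fun ω _ => by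
      by_cases hω : ω ∈ {ω : Set (Sym2 V) | openCluster (ω ∩ edgesIn U) o = ↑W}
      · have hK : openCluster (ω ∩ edgesIn U) o = ↑W := hω
        rw [gneg_ind_rD_eq_zero_of_mem hK hgW hxX hxW]; ring
      · rw [ind_of_not_mem hω]; ring
    rw [this, mul_zero]
  · -- a pocket avoiding `g`: factor it off and work in `U ∖ W`
    set U' := U \ W with hU'
    set EF := ∑ ω, weight w ω * F (rC U' g ω) with hEF
    set EX := ∑ ω, weight w ω * ind (rD U' g X) ω with hEX
    set EY := ∑ ω, weight w ω * ind (rD U' g Y) ω with hEY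
    set EXY := ∑ ω, weight w ω * ind (rD U' g (X ∪ Y)) ω with hEXY
    set E₁ := ∑ ω, weight w ω * (F (rC U' g ω) * ind (rD U' g X) ω) with hE₁
    have f1 : I₁ W = P W * E₁ := gneg_blockFactor w hm ho hgW F X
    have f4 : I₄ W = P W * EXY := by
      have := gneg_blockFactor w hm ho hgW (fun _ => (1 : ℝ)) (X ∪ Y)
      simpa only [one_mul] using this
    have hEF : 0 ≤ EF :=
      Finset.sum_nonneg fun ω _ => mul_nonneg (weight_nonneg hw0 hw1 ω) (hF0 _)
    have hEX : 0 ≤ EX :=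
      Finset.sum_nonneg fun ω _ => mul_nonneg (weight_nonneg hw0 hw1 ω) (ind_nonneg _ _)
    have hEY : 0 ≤ EY :=
      Finset.sum_nonneg fun ω _ => mul_nonneg (weight_nonneg hw0 hw1 ω) (ind_nonneg _ _)
    -- (c1) Harris in `U'`, increasing × decreasing
    have c1 : E₁ ≤ EF * EX :=
      harris_mono_anti hw0 hw1 hm (fun _ => hF0 _) (fun a b hab => hF (rC_mono U' g hab))
        (ind_rD_antitone U' g X) (fun _ => ind_le_one _ _)
    -- (c2) fewer vertices, more avoidance
    have hUU' : rD U g Y ⊆ rD U' g Y := fun _ hω x hx hr => hω x hx (hr.mono (openGraph_le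
      (Set.inter_subset_inter_right _ (edgesIn_mono Finset.sdiff_subset))))
    have c2 : A₂ ≤ EY := Finset.sum_le_sum fun ω _ => mul_le_mul_of_nonneg_left
      (ind_mono hUU' ω) (weight_nonneg hw0 hw1 ω)
    -- (c3) fewer vertices, smaller cluster
    have c3 : EF ≤ A₃ := Finset.sum_le_sum fun ω _ => mul_le_mul_of_nonneg_left
      (hF (openEdgeCluster_mono (Set.inter_subset_inter_right _
        (edgesIn_mono Finset.sdiff_subset)) g)) (weight_nonneg hw0 hw1 ω)
    -- (c4) Harris in `U'`, decreasing × decreasing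
    have c4 : EX * EY ≤ EXY := by
      have h := harris_anti_anti hw0 hw1 hm (ind_rD_antitone U' g X) (ind_rD_antitone U' g Y)
        (fun _ => ind_le_one _ _) (fun _ => ind_le_one _ _)
      refine h.trans (le_of_eq (Finset.sum_congr rfl fun ω _ => ?_))
      rw [rD_union, ind_inter]
    -- assemble
    rw [f1, f4]
    have hE₁A₂ : E₁ * A₂ ≤ EF * EX * EY := mul_le_mul c1 c2 hA₂ (mul_nonneg hEF hEX)
    have h34 : EF * EX * EY ≤ A₃ * EXY := by
      rw [mul_assoc]
      exact mul_le_mul c3 c4 (mul_nonneg hEX hEY) hA₃0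
    calc q X ↑W * (P W * E₁) * A₂ = q X ↑W * P W * (E₁ * A₂) := by ring
      _ ≤ q (X ∪ Y) ↑W * P W * (A₃ * EXY) :=
          mul_le_mul (mul_le_mul_of_nonneg_right (hqm _) hPW) (hE₁A₂.trans h34)
            (mul_nonneg (Finset.sum_nonneg fun ω _ => mul_nonneg (weight_nonneg hw0 hw1 ω)
              (mul_nonneg (hF0 _) (ind_nonneg _ _))) hA₂) (mul_nonneg hqXY hPW)
      _ = A₃ * (q (X ∪ Y) ↑W * (P W * EXY)) := by ring

/-- **Registered sub-goal `stub_gnegBase_k17`** (siege k17): the base case `X ∩ Y = ∅` of the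
decorated BHK inequality, closed form of `gneg_base` (vertex type in `Type`). [this project] -/
theorem stub_gnegBase_k17 : ∀ (V : Type) [Fintype V] (w : Sym2 V → ℝ), (∀ e, 0 ≤ w e) → (∀ e, w e ≤ 1) → (∑ ω, weight w ω = 1) → ∀ (U : Finset V) (o g : V), o ∈ U → ∀ (X Y : Set V) (F : Set (Sym2 V) → ℝ), Monotone F → (∀ a, 0 ≤ F a) → ∀ (q : Set V → Set V → ℝ), (∀ K, 0 ≤ q X K) → (∀ K, q X K ≤ q (X ∪ Y) K) → (∀ K, g ∈ K → q X K ≠ 0 → ∃ x ∈ X, x ∈ K) → (∑ ω, weight w ω * (F (rC U g ω) * q X (openCluster (ω ∩ edgesIn U) o) * ind (rD U g X) ω)) * (∑ ω, weight w ω * ind (rD U g Y) ω) ≤ (∑ ω, weight w ω * F (rC U g ω)) * ∑ ω, weight w ω * (q (X ∪ Y) (openCluster (ω ∩ edgesIn U) o) * ind (rD U g (X ∪ Y)) ω) :=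
  fun _ _ w hw0 hw1 hm _ _ _ ho _ _ F hF hF0 q hq0 hqm hqg =>
    gneg_base w hw0 hw1 hm ho F hF hF0 q hq0 hqm hqg

end Base

end Summit.CriticalPhenomena.PercolationContinuityZ3.Theorems
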